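import Summits.BirchSwinnertonDyer.Rank1Residual.Supersingular.BlindPointFlatTwo
import Literature.NumberTheory.EllipticCurves.PadicFormalLogOrder
import Literature.NumberTheory.EllipticCurves.QuadraticTwist
import Literature.NumberTheory.EllipticCurves.BSDRootNumberSmallConductorProofs
import Literature.NumberTheory.EllipticCurves.Rank1Residual.Predicates
import HarnessLib

/-!
# Sketch41 — MEMO-an §41 (v2.00) typed candidates: the SIGN of the blind flat value at `ψ₂`
# on the odd-twist locus, and the `Δ < 0`-certified forms of the §40 value law.

Setting as in `BlindFlatLogSquareAN52` (§40): `E/ℚ` good supersingular at `2`, newform `f`, Sprung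
pair `(Ls, Lf)` at `2`, blind point `T = −2` (`ψ₂`, the character of `ℚ(√2)`), odd-twist locus
`w(E)·χ₈(N_E) = −1`, `W₂` a globally minimal model of `E^{(2)} = E ⊗ χ_{ℚ(√2)}` (conductor `64 N_E`).
All statements are in TREE units (`θ_n = mazurTateElement f 2 n`, period `plusPeriod f = Ω_BSD`
including `c_∞`); the engine↔tree scalar is MEASURED (`x⁺_PARI(0) = −(c_∞(E)/2)⁻¹ …`, i.e.
`S_n^{engine} = −(c_∞(E)/2)·θ_n^{tree}`: `λ = −2` on `Δ > 0`, `λ = −1` on `Δ < 0`, census41 §0).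

* `FlatBlindSignAtChi8` (P-an-41S): for `a₂ = ±2` the UNIT of `b = L♭₂(E)(ψ₂) = evalAt (−2) Lf`
  satisfies `b·2^{−v₂(b)} ≡ (a₂/2) · Tam(E^{(2)})_odd (mod 4)`.  BSD-free and Ш-free (odd squares are
  `1 mod 8`, `#E^{(2)}(ℚ)_tors` enters squared); the odd-twist twin of the even-twist shadow sign
  `5·L♭(−2) = −a₂·L♯(−2)` (tree `flatLaw_evalAt_neg_two_of_rootNumber`).
-/

noncomputable section

open scoped Classical MatrixGroups ModularForm

open WeierstrassCurve CongruenceSubgroup Literature.NumberTheory.EllipticCurves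
  Literature.NumberTheory.EllipticCurves.ModularForms Literature.NumberTheory.EllipticCurves.Sprung2017
  Literature.NumberTheory.EllipticCurves.Rank1Residual
  Summit.BirchSwinnertonDyer.Rank1Residual.Supersingular
  Summit.BirchSwinnertonDyer.Rank1Residual.Supersingular.BlindLever

namespace Summit.BirchSwinnertonDyer.Cruxes.RankOneAtTwoBigImageOddLocal.BlindSignAN53

/-- **P-an-41S `FlatBlindSignAtChi8`** (MEMO-an §41): the SIGN LAW of the blind flat value.
For `E/ℚ` good supersingular at `2` with `a₂(E) = ±2` (`W.frobeniusTrace 2 ≠ 0`), newform `f`,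
Sprung pair `(Ls, Lf)` at `2`, on the odd-twist locus `w(E)·χ₈(N_E) = −1`, and a globally minimal
model `W₂` of the twist `E^{(2)}` of analytic rank `1`: writing `evalAt (−2) Lf = u · 2ⁿ` with
`u ∈ ℤ₂ˣ`, one has `u ≡ (a₂/2) · (Tam(W₂))_odd (mod 4)`, where `(m)_odd = m / 2^{v₂(m)}`. -/
def FlatBlindSignAtChi8 : Prop :=
  ∀ (W : WeierstrassCurve ℚ) [W.IsElliptic] [W.IsGloballyMinimal] [NeZero (W.conductorNorm ℤ)]
    (f : CuspForm (Gamma0 (W.conductorNorm ℤ)) 2),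
    IsNewformOf W f → GoodSS W 2 → W.frobeniusTrace 2 ≠ 0 →
    W.rootNumber * ZMod.χ₈ (W.conductorNorm ℤ : ZMod 8) = -1 →
    ∀ (Ls Lf : IwasawaAlgebra 2), IsSprungPair f 2 (W.frobeniusTrace 2) Ls Lf →
    ∀ (W₂ : WeierstrassCurve ℚ) [W₂.IsElliptic] [W₂.IsGloballyMinimal],
      (∃ C : WeierstrassCurve.VariableChange ℚ, C • W.quadraticTwist 2 = W₂) →
      W₂.analyticRank = 1 →
    ∀ (u : ℤ_[2]ˣ) (n : ℕ), evalAt (-2 : ℤ_[2]) Lf = (u : ℤ_[2]) * 2 ^ n →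
      PadicInt.toZModPow 2 (u : ℤ_[2]) =
        ((W.frobeniusTrace 2 / 2 : ℤ) : ZMod (2 ^ 2)) *
          ((W₂.tamagawaProduct / 2 ^ padicValNat 2 W₂.tamagawaProduct : ℕ) : ZMod (2 ^ 2))

end Summit.BirchSwinnertonDyer.Cruxes.RankOneAtTwoBigImageOddLocal.BlindSignAN53
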